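import Mathlib.NumberTheory.ArithmeticFunction.VonMangoldt
import Mathlib.NumberTheory.Harmonic.EulerMascheroni
import Mathlib.NumberTheory.Harmonic.Bounds
import Mathlib.Analysis.InnerProductSpace.Basic
import Mathlib.Analysis.Complex.ExponentialBounds
import Literature.Analysis.SpecialFunctions.EulerMascheroniBounds
import HarnessLib

/-!
# Perron-pivot bricks: the abstract pivot Schur complement, the exact Perron row of the Helson form,
# the screening profile and the closure arithmetic (STUB-PLAN `stub_windowCore`, helpers B3, B2c, B2b, B8)

Crux `WeilComb.CombShapePositivity` (item stmt-RiemannHypothesis-11229), line `Sketch`, STUB-PLAN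
`stub_windowCore` Phase B (typed companion `Cruxes/CombShapePositivity/SketchStubPlanWindowCore.lean`):
the estimate-free bricks of the Perron-pivot Schur-complement architecture
(`a = βu + y`, `y ⊥ u`, `u_m = m^{-1/2}`):

* `schur_pivot` (B3) — for a symmetric linear map `K` of a complex inner product space and any vector `u`:
  `μ ≤ Re⟪Ku,u⟫`, `|⟪Ku,h⟫|² ≤ c‖h‖²` and `κ‖h‖² ≤ Re⟪Kh,h⟫` for `h ⊥ u`, `0 ≤ μ`, `0 ≤ κ`, `c ≤ μκ`
  ⟹ `0 ≤ Re⟪Ka,a⟫` for every `a` (sibling of the landed `WeilCombBohrFejer.temple_inner`);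
* `stub_helsonPerronRow` (B2c, registered on the crux) — the Perron ray is an exact row of the Helson form:
  `Σ_{n ∣ m} Λ(n) n^{-1/2} (m/n)^{-1/2} + Σ_{n ≤ M/m} Λ(n) n^{-1/2} (nm)^{-1/2} = m^{-1/2}(log m + ψ₁(M/m))`;
* `screening_profile_bounds` (B2b) — `0 ≤ 2H_M − H_{M−m} − H_{M+m} + 3/(2m)` and
  `2H_M − H_{M−m} − H_{M+m} ≤ −log(1 − (m/M)²) + 1/(M−m)` for `1 ≤ m < M`;
* `closure_constants` (B8) — `1/16 ≤ (1/20)(1/5) H_M` for `M ≥ 400` (`H_M > log M + γ ≥ 5.7 + 0.577`).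
-/

noncomputable section

-- the sub-problem path RiemannHypothesis/RiemannHypothesis duplicates a namespace (D-0017)
set_option linter.dupNamespace false

open scoped BigOperators ComplexConjugate InnerProductSpace
open Finset ArithmeticFunction

namespace Summit.RiemannHypothesis.RiemannHypothesis.Theorems.WeilCombPivotBricks

/-! ### B3: the pivot Schur complement -/

section Pivot

variable {V : Type*} [NormedAddCommGroup V] [InnerProductSpace ℂ V]

/-- **B3 (pivot Schur complement).** Let `K` be a symmetric linear map of a complex inner product space and
`u` any vector ("pivot"). If `μ ≤ Re⟪Ku,u⟫` with `μ ≥ 0`, and for every `h ⊥ u` the cross term satisfies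
`|⟪Ku,h⟫|² ≤ c‖h‖²` and the form is coercive `κ‖h‖² ≤ Re⟪Kh,h⟫` (`κ ≥ 0`), then `c ≤ μκ` makes the form
positive semidefinite: writing `a = βu + h`, `Re⟪Ka,a⟫ = |β|² Re⟪Ku,u⟫ + 2Re(β̄⟪Ku,h⟫) + Re⟪Kh,h⟫
≥ μ|β|² − 2|β|√c‖h‖ + κ‖h‖² ≥ 0`. [folklore] -/
theorem schur_pivot (K : V →ₗ[ℂ] V) (hK : ∀ x y : V, ⟪K x, y⟫_ℂ = ⟪x, K y⟫_ℂ) (u : V)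
    {μ κ c : ℝ} (hμ : 0 ≤ μ) (hκ : 0 ≤ κ) (hRay : μ ≤ (⟪K u, u⟫_ℂ).re)
    (hres : ∀ h : V, ⟪u, h⟫_ℂ = 0 → ‖⟪K u, h⟫_ℂ‖ ^ 2 ≤ c * ‖h‖ ^ 2)
    (hcoer : ∀ h : V, ⟪u, h⟫_ℂ = 0 → κ * ‖h‖ ^ 2 ≤ (⟪K h, h⟫_ℂ).re)
    (hclose : c ≤ μ * κ) (a : V) :
    0 ≤ (⟪K a, a⟫_ℂ).re := by
  by_cases hu0 : u = 0
  · -- no pivot: everything is orthogonal to `u`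
    have hall : ∀ h : V, ⟪u, h⟫_ℂ = 0 := fun h ↦ by rw [hu0, inner_zero_left]
    have := hcoer a (hall a)
    nlinarith [norm_nonneg a]
  -- decompose `a = β • u + h`, `h ⊥ u`
  have hun : ‖u‖ ≠ 0 := norm_ne_zero_iff.2 hu0
  have huu : ⟪u, u⟫_ℂ = ((‖u‖ ^ 2 : ℝ) : ℂ) := by
    rw [inner_self_eq_norm_sq_to_K]; norm_cast
  have huu0 : ⟪u, u⟫_ℂ ≠ 0 := by
    rw [huu]; exact_mod_cast pow_ne_zero 2 hun
  set β : ℂ := ⟪u, a⟫_ℂ / ⟪u, u⟫_ℂ with hβ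
  set h : V := a - β • u with hh
  have huh : ⟪u, h⟫_ℂ = 0 := by
    rw [hh, inner_sub_right, inner_smul_right, hβ, div_mul_cancel₀ _ huu0, sub_self]
  have ha : a = β • u + h := by rw [hh]; abel
  -- `⟪Ku,u⟫` is real
  have hKuu_im : (⟪K u, u⟫_ℂ).im = 0 := by
    have hreal : conj ⟪K u, u⟫_ℂ = ⟪K u, u⟫_ℂ := by rw [inner_conj_symm, ← hK]
    have := congrArg Complex.im hreal
    simp only [Complex.conj_im] at this
    linarith
  have hhKu : ⟪K h, u⟫_ℂ = conj ⟪K u, h⟫_ℂ := by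
    rw [hK, ← inner_conj_symm]
  -- expansion of the form
  have hform : (⟪K a, a⟫_ℂ).re =
      ‖β‖ ^ 2 * (⟪K u, u⟫_ℂ).re + 2 * (conj β * ⟪K u, h⟫_ℂ).re + (⟪K h, h⟫_ℂ).re := by
    have e : ⟪K a, a⟫_ℂ = conj β * β * ⟪K u, u⟫_ℂ + conj β * ⟪K u, h⟫_ℂ + β * ⟪K h, u⟫_ℂ +
        ⟪K h, h⟫_ℂ := by
      rw [ha, map_add, map_smul, inner_add_left, inner_add_right, inner_add_right, inner_smul_left,
        inner_smul_left, inner_smul_right, inner_smul_right]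
      ring
    rw [e, hhKu]
    have e2 : conj β * β = ((‖β‖ ^ 2 : ℝ) : ℂ) := by
      rw [mul_comm, Complex.mul_conj, Complex.normSq_eq_norm_sq]
    rw [e2]
    simp only [Complex.add_re, Complex.mul_re, Complex.ofReal_re, Complex.ofReal_im,
      sub_zero, Complex.conj_re, Complex.conj_im, hKuu_im, mul_zero]
    ring
  -- the three estimates
  set s : ℝ := ‖⟪K u, h⟫_ℂ‖ with hs
  set b : ℝ := ‖β‖ with hb
  set t : ℝ := ‖h‖ with ht
  have hs0 : 0 ≤ s := norm_nonneg _
  have hb0 : 0 ≤ b := norm_nonneg _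
  have ht0 : 0 ≤ t := norm_nonneg _
  have hcross : -(2 * b * s) ≤ 2 * (conj β * ⟪K u, h⟫_ℂ).re := by
    have h1 : |(conj β * ⟪K u, h⟫_ℂ).re| ≤ ‖conj β * ⟪K u, h⟫_ℂ‖ := Complex.abs_re_le_norm _
    have h2 : ‖conj β * ⟪K u, h⟫_ℂ‖ = b * s := by rw [norm_mul, Complex.norm_conj]
    have h3 := neg_abs_le (conj β * ⟪K u, h⟫_ℂ).re
    linarith
  have hres' : s ^ 2 ≤ c * t ^ 2 := hres h huh
  have hcoer' : κ * t ^ 2 ≤ (⟪K h, h⟫_ℂ).re := hcoer h huh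
  have hRay' : b ^ 2 * μ ≤ b ^ 2 * (⟪K u, u⟫_ℂ).re := mul_le_mul_of_nonneg_left hRay (sq_nonneg _)
  -- the scalar inequality `μ b² − 2 b s + κ t² ≥ 0` from `s² ≤ μ κ t²`
  have hst : s ^ 2 ≤ μ * κ * t ^ 2 := hres'.trans (by nlinarith [sq_nonneg t])
  have key : 0 ≤ μ * b ^ 2 - 2 * b * s + κ * t ^ 2 := by
    rcases eq_or_lt_of_le hμ with hμ0 | hμp
    · -- `μ = 0`: then `s = 0`
      have hs2 : s ^ 2 ≤ 0 := by rw [← hμ0] at hst; simpa using hst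
      have hs00 : s = 0 := by nlinarith
      rw [hs00, ← hμ0]
      nlinarith
    · -- `μ > 0`: `μ(μ b² − 2 b s + κ t²) = (μ b − s)² + (μ κ t² − s²) ≥ 0`
      have : 0 ≤ μ * (μ * b ^ 2 - 2 * b * s + κ * t ^ 2) := by
        nlinarith [sq_nonneg (μ * b - s)]
      exact nonneg_of_mul_nonneg_right this hμp
  rw [hform]
  nlinarith

end Pivot

/-! ### B2c: the Perron ray is an exact row of the Helson form -/

/-- **Stub `stub_helsonPerronRow` (B2c; registered on crux stmt-RiemannHypothesis-11229).** For
`1 ≤ m ≤ M`, the down-edges `n ∣ m` and the up-edges `n ≤ M/m` of the Perron ray `u_k = k^{-1/2}` at `m` sum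
to `u_m (log m + ψ₁(M/m))` exactly:
`Σ_{n ∣ m} Λ(n) n^{-1/2} (m/n)^{-1/2} + Σ_{n ≤ M/m} Λ(n) n^{-1/2} (nm)^{-1/2} = m^{-1/2} (log m + Σ_{n ≤ M/m} Λ(n)/n)`
(`Σ_{n ∣ m} Λ(n) = log m`). Hence the prime part of the pivot residual is the explicit profile
`u_m (E₁(M/m) − mean)`. [folklore] -/
theorem stub_helsonPerronRow : ∀ (M m : ℕ), m ∈ Finset.Icc 1 M →
    ∑ n ∈ m.divisors, (ArithmeticFunction.vonMangoldt n : ℝ) / Real.sqrt n *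
        (Real.sqrt (((m / n : ℕ) : ℝ)))⁻¹ +
      ∑ n ∈ Finset.Icc 1 (M / m), (ArithmeticFunction.vonMangoldt n : ℝ) / Real.sqrt n *
        (Real.sqrt (((n * m : ℕ) : ℝ)))⁻¹ =
      (Real.sqrt (m : ℝ))⁻¹ *
        (Real.log m + ∑ n ∈ Finset.Icc 1 (M / m), (ArithmeticFunction.vonMangoldt n : ℝ) / n) := by
  intro M m hm
  obtain ⟨hm1, -⟩ := Finset.mem_Icc.1 hm
  have hm0 : (0 : ℝ) < m := by exact_mod_cast hm1
  have hsm : 0 < Real.sqrt m := Real.sqrt_pos.2 hm0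
  -- down-edges
  have hdown : ∑ n ∈ m.divisors, (Λ n : ℝ) / Real.sqrt n * (Real.sqrt (((m / n : ℕ) : ℝ)))⁻¹ =
      (Real.sqrt (m : ℝ))⁻¹ * Real.log m := by
    rw [← vonMangoldt_sum, Finset.mul_sum]
    refine Finset.sum_congr rfl fun n hn ↦ ?_
    have hn0 : 0 < n := Nat.pos_of_mem_divisors hn
    have hdvd : n ∣ m := Nat.dvd_of_mem_divisors hn
    have hprod : ((n : ℕ) : ℝ) * ((m / n : ℕ) : ℝ) = m := by
      exact_mod_cast Nat.mul_div_cancel' hdvd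
    have hq0 : (0 : ℝ) ≤ ((m / n : ℕ) : ℝ) := Nat.cast_nonneg _
    have hsq : Real.sqrt n * Real.sqrt (((m / n : ℕ) : ℝ)) = Real.sqrt m := by
      rw [← Real.sqrt_mul (Nat.cast_nonneg n), hprod]
    have hsn : 0 < Real.sqrt n := Real.sqrt_pos.2 (by exact_mod_cast hn0)
    have hsq' : Real.sqrt (((m / n : ℕ) : ℝ)) = Real.sqrt m / Real.sqrt n := by
      rw [← hsq]; field_simp
    rw [hsq']
    field_simp
  -- up-edges
  have hup : ∑ n ∈ Finset.Icc 1 (M / m), (Λ n : ℝ) / Real.sqrt n * (Real.sqrt (((n * m : ℕ) : ℝ)))⁻¹ =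
      (Real.sqrt (m : ℝ))⁻¹ * ∑ n ∈ Finset.Icc 1 (M / m), (Λ n : ℝ) / n := by
    rw [Finset.mul_sum]
    refine Finset.sum_congr rfl fun n hn ↦ ?_
    obtain ⟨hn1, -⟩ := Finset.mem_Icc.1 hn
    have hn0 : (0 : ℝ) < n := by exact_mod_cast hn1
    have hsn : 0 < Real.sqrt n := Real.sqrt_pos.2 hn0
    have hsq : Real.sqrt (((n * m : ℕ) : ℝ)) = Real.sqrt n * Real.sqrt m := by
      rw [Nat.cast_mul, Real.sqrt_mul (Nat.cast_nonneg n)]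
    rw [hsq]
    field_simp
    rw [Real.sq_sqrt hn0.le]
  rw [hdown, hup]
  ring

/-! ### B2b: the screening profile -/

/-- `H_n = Σ_{k ∈ (0, n]} 1/k` over `ℝ`. [folklore] -/
theorem harmonic_eq_sum_Ioc (n : ℕ) : (harmonic n : ℝ) = ∑ k ∈ Finset.Ioc 0 n, (1 : ℝ) / k := by
  rw [harmonic_eq_sum_Icc, show Finset.Icc 1 n = Finset.Ioc 0 n from Finset.Icc_add_one_left_eq_Ioc 0 n]
  push_cast
  refine Finset.sum_congr rfl fun k _ ↦ ?_
  rw [one_div]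

/-- Lower telescoping: `log(n+1) − log(m+1) ≤ Σ_{m < k ≤ n} 1/k` for `m ≤ n`. [folklore] -/
theorem log_sub_log_le_sum_Ioc_one_div (m : ℕ) :
    ∀ n : ℕ, m ≤ n → Real.log ((n : ℝ) + 1) - Real.log ((m : ℝ) + 1) ≤ ∑ k ∈ Ioc m n, (1 : ℝ) / k := by
  intro n hn
  induction n, hn using Nat.le_induction with
  | base => simp
  | succ n hmn ih =>
    rw [Finset.sum_Ioc_succ_top (by omega), Nat.cast_succ]
    have hn1 : (0 : ℝ) < (n : ℝ) + 1 := by positivity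
    have hstep : Real.log ((n : ℝ) + 1 + 1) - Real.log ((n : ℝ) + 1) ≤ 1 / ((n : ℝ) + 1) := by
      rw [← Real.log_div (by linarith) hn1.ne']
      have h := Real.log_le_sub_one_of_pos (show 0 < ((n : ℝ) + 1 + 1) / (n + 1) by positivity)
      have e : ((n : ℝ) + 1 + 1) / (n + 1) - 1 = 1 / (n + 1) := by field_simp; ring
      linarith
    linarith

/-- **B2b (screening profile).** For `1 ≤ m < M`, with `H` the harmonic numbers:
`0 ≤ 2H_M − H_{M−m} − H_{M+m} + 3/(2m)` and `2H_M − H_{M−m} − H_{M+m} ≤ −log(1 − (m/M)²) + 1/(M−m)`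
(`2H_M − H_{M−m} − H_{M+m} = Σ_{M−m<k≤M} 1/k − Σ_{M<k≤M+m} 1/k`; each block against the logarithm). The pole
row `+Rε H_M √m` of the Perron pivot and its archimedean row cancel to the boundary layer `(Rε/2)√m s_M(m)`
with `s_M(m) = 2H_M − H_{M−m} − H_{M+m} + 3/(2m)`. [folklore] -/
theorem screening_profile_bounds (M m : ℕ) (hm : 1 ≤ m) (hmM : m < M) :
    0 ≤ 2 * (harmonic M : ℝ) - (harmonic (M - m) : ℝ) - (harmonic (M + m) : ℝ) + 3 / (2 * (m : ℝ)) ∧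
    2 * (harmonic M : ℝ) - (harmonic (M - m) : ℝ) - (harmonic (M + m) : ℝ) ≤
      -Real.log (1 - ((m : ℝ) / M) ^ 2) + 1 / ((M : ℝ) - m) := by
  have hM0 : (0 : ℝ) < M := by exact_mod_cast (show 0 < M by omega)
  have hm0 : (0 : ℝ) < m := by exact_mod_cast hm
  have hMm : (0 : ℝ) < (M : ℝ) - m := by
    have : (m : ℝ) < M := by exact_mod_cast hmM
    linarith
  -- the two blocks
  set A : ℝ := ∑ k ∈ Ioc (M - m) M, (1 : ℝ) / k with hA
  set B : ℝ := ∑ k ∈ Ioc M (M + m), (1 : ℝ) / k with hB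
  have hsplit1 : (harmonic M : ℝ) = (harmonic (M - m) : ℝ) + A := by
    rw [harmonic_eq_sum_Ioc, harmonic_eq_sum_Ioc, hA,
      ← Finset.sum_Ioc_consecutive _ (Nat.zero_le (M - m)) (Nat.sub_le M m)]
  have hsplit2 : (harmonic (M + m) : ℝ) = (harmonic M : ℝ) + B := by
    rw [harmonic_eq_sum_Ioc, harmonic_eq_sum_Ioc, hB,
      ← Finset.sum_Ioc_consecutive _ (Nat.zero_le M) (Nat.le_add_right M m)]
  have hkey : 2 * (harmonic M : ℝ) - (harmonic (M - m) : ℝ) - (harmonic (M + m) : ℝ) = A - B := by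
    rw [hsplit2, hsplit1]; ring
  rw [hkey]
  have hcast : ((M - m : ℕ) : ℝ) = (M : ℝ) - m := by
    rw [Nat.cast_sub hmM.le]
  constructor
  · -- `A ≥ m/M ≥ B`
    have hA_ge : (m : ℝ) * (1 / M) ≤ A := by
      have h1 : ∑ k ∈ Ioc (M - m) M, (1 : ℝ) / M ≤ A :=
        Finset.sum_le_sum fun k hk ↦ by
          obtain ⟨hk1, hk2⟩ := Finset.mem_Ioc.1 hk
          have hk0 : (0 : ℝ) < k := by exact_mod_cast (show 0 < k by omega)
          exact div_le_div_of_nonneg_left zero_le_one hk0 (by exact_mod_cast hk2)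
      have h2 : ∑ k ∈ Ioc (M - m) M, (1 : ℝ) / M = (m : ℝ) * (1 / M) := by
        rw [Finset.sum_const, Nat.card_Ioc, nsmul_eq_mul]
        congr 1
        push_cast [Nat.sub_sub_self hmM.le]
        ring
      linarith
    have hB_le : B ≤ (m : ℝ) * (1 / M) := by
      have h1 : B ≤ ∑ k ∈ Ioc M (M + m), (1 : ℝ) / M :=
        Finset.sum_le_sum fun k hk ↦ by
          obtain ⟨hk1, -⟩ := Finset.mem_Ioc.1 hk
          exact div_le_div_of_nonneg_left zero_le_one hM0 (by exact_mod_cast hk1.le)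
      have h2 : ∑ k ∈ Ioc M (M + m), (1 : ℝ) / M = (m : ℝ) * (1 / M) := by
        rw [Finset.sum_const, Nat.card_Ioc, nsmul_eq_mul]
        congr 1
        push_cast [Nat.add_sub_cancel_left]
        ring
      linarith
    have h3 : 0 ≤ 3 / (2 * (m : ℝ)) := by positivity
    linarith
  · -- `A ≤ log M − log(M−m)`, `B ≥ log(M+m+1) − log(M+1) ≥ log(M+m) − log M − 1/(M−m)`
    have hA_le : A ≤ Real.log M - Real.log ((M : ℝ) - m) := by
      -- upper telescoping `Σ_{M−m < k ≤ n} 1/k ≤ log n − log(M−m)` (as in `WeilCombHelsonGK7`)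
      have gen : ∀ n : ℕ, M - m ≤ n →
          ∑ k ∈ Ioc (M - m) n, (1 : ℝ) / k ≤ Real.log n - Real.log ((M - m : ℕ) : ℝ) := by
        intro n hn
        induction n, hn using Nat.le_induction with
        | base => simp
        | succ n hmn ih =>
          rw [Finset.sum_Ioc_succ_top (by omega), Nat.cast_succ]
          have hn0 : (0 : ℝ) < n := by exact_mod_cast (show 0 < n by omega)
          have hstep : 1 / ((n : ℝ) + 1) ≤ Real.log ((n : ℝ) + 1) - Real.log n := by
            rw [← Real.log_div (by linarith) hn0.ne']
            have h := Real.log_le_sub_one_of_pos (show 0 < (n : ℝ) / (n + 1) by positivity)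
            rw [Real.log_div hn0.ne' (by linarith)] at h
            rw [Real.log_div (by linarith) hn0.ne']
            have e : (n : ℝ) / (n + 1) - 1 = -(1 / (n + 1)) := by field_simp; ring
            linarith
          linarith
      have h := gen M (Nat.sub_le M m)
      rwa [hcast] at h
    have hB_ge : Real.log ((M : ℝ) + m + 1) - Real.log ((M : ℝ) + 1) ≤ B := by
      have h := log_sub_log_le_sum_Ioc_one_div M (M + m) (Nat.le_add_right M m)
      push_cast at h
      exact h
    -- `−log(1 − (m/M)²) = 2 log M − log(M−m) − log(M+m)`
    have hlog : -Real.log (1 - ((m : ℝ) / M) ^ 2) =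
        2 * Real.log M - Real.log ((M : ℝ) - m) - Real.log ((M : ℝ) + m) := by
      have e : 1 - ((m : ℝ) / M) ^ 2 = ((M : ℝ) - m) * ((M : ℝ) + m) / ((M : ℝ) * M) := by
        field_simp; ring
      rw [e, Real.log_div (by positivity) (by positivity), Real.log_mul hMm.ne' (by positivity),
        Real.log_mul hM0.ne' hM0.ne']
      ring
    rw [hlog]
    -- `log(M+1) − log M ≤ 1/M ≤ 1/(M−m)` and `log(M+m) ≤ log(M+m+1)`
    have h1 : Real.log ((M : ℝ) + 1) - Real.log M ≤ 1 / M := by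
      rw [← Real.log_div (by positivity) hM0.ne']
      have h := Real.log_le_sub_one_of_pos (show 0 < ((M : ℝ) + 1) / M by positivity)
      have e : ((M : ℝ) + 1) / M - 1 = 1 / M := by field_simp; ring
      linarith
    have h2 : (1 : ℝ) / M ≤ 1 / ((M : ℝ) - m) :=
      div_le_div_of_nonneg_left zero_le_one hMm (by linarith)
    have h3 : Real.log ((M : ℝ) + m) ≤ Real.log ((M : ℝ) + m + 1) :=
      Real.log_le_log (by positivity) (by linarith)
    linarith

/-! ### B8: closure arithmetic -/

/-- `log 400 ≥ 5.7` (`e^{5.7} = e⁵ e^{0.7} ≤ 148.42 · 2.0147 < 400`). [folklore] -/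
theorem log_400_ge : (5.7 : ℝ) ≤ Real.log 400 := by
  rw [Real.le_log_iff_exp_le (by norm_num)]
  have h1 : Real.exp 1 < 2.7182818286 := Real.exp_one_lt_d9
  have h07 : Real.exp (0.7 : ℝ) ≤ 2.0147 := by
    have := Real.exp_bound (x := (0.7 : ℝ)) (by norm_num) (n := 4) (by norm_num)
    simp only [Finset.sum_range_succ, Finset.sum_range_zero, Nat.factorial] at this
    have habs := abs_sub_le_iff.1 this
    norm_num at habs
    linarith [habs.1]
  have he5 : Real.exp (5.7 : ℝ) = Real.exp 1 ^ 5 * Real.exp 0.7 := by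
    rw [← Real.exp_nat_mul, ← Real.exp_add]; norm_num
  rw [he5]
  have h5 : Real.exp 1 ^ 5 ≤ (2.7182818286 : ℝ) ^ 5 :=
    pow_le_pow_left₀ (Real.exp_pos 1).le h1.le 5
  calc Real.exp 1 ^ 5 * Real.exp 0.7 ≤ (2.7182818286 : ℝ) ^ 5 * 2.0147 :=
        mul_le_mul h5 h07 (Real.exp_pos _).le (by positivity)
    _ ≤ 400 := by norm_num

/-- `H_M > log M + γ` for `M ≥ 1` (Mathlib's strictly decreasing upper Euler–Mascheroni sequence). [folklore] -/
theorem log_add_eulerMascheroni_lt_harmonic {M : ℕ} (hM : 1 ≤ M) :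
    Real.log M + Real.eulerMascheroniConstant < (harmonic M : ℝ) := by
  have h := Real.eulerMascheroniConstant_lt_eulerMascheroniSeq' M
  rw [Real.eulerMascheroniSeq', if_neg (by omega)] at h
  linarith

/-- `Σ_{m ≤ M} 1/m ≥ 6.27` for `M ≥ 400` (`> log 400 + γ ≥ 5.7 + 0.5772`; `H₄₀₀ = 6.5699…`). [folklore] -/
theorem sum_one_div_ge_of_le {M : ℕ} (hM : 400 ≤ M) :
    (6.27 : ℝ) ≤ ∑ m ∈ Finset.Icc 1 M, (1 : ℝ) / m := by
  have h1 := log_add_eulerMascheroni_lt_harmonic (M := M) (by omega)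
  have h2 : Real.log 400 ≤ Real.log M := Real.log_le_log (by norm_num) (by exact_mod_cast hM)
  have h3 := log_400_ge
  have h4 := Literature.Analysis.SpecialFunctions.Real.eulerMascheroniConstant_gt_d8
  have h5 : (harmonic M : ℝ) = ∑ m ∈ Finset.Icc 1 M, (1 : ℝ) / m := by
    rw [harmonic_eq_sum_Ioc, show Finset.Icc 1 M = Finset.Ioc 0 M from Finset.Icc_add_one_left_eq_Ioc 0 M]
  linarith

/-- **B8 (closure arithmetic).** `c_* ≤ μ̂ κ₀ H_M` with `c_* = 1/16`, `μ̂ = 1/20`, `κ₀ = 1/5` holds iff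
`H_M ≥ 6.25`, true for every `M ≥ 400`. [folklore] -/
theorem closure_constants (M : ℕ) (hM : 400 ≤ M) :
    (1 : ℝ) / 16 ≤ 1 / 20 * (1 / 5) * ∑ m ∈ Finset.Icc 1 M, (1 : ℝ) / m := by
  have := sum_one_div_ge_of_le hM
  linarith

end Summit.RiemannHypothesis.RiemannHypothesis.Theorems.WeilCombPivotBricks

end
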